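import Mathlib

/-!
# Rank-aware H-constant lemma (hidden-corner lemma, crux stmt-MatrixMultiplication-10752)

Support file for crux item `stmt-MatrixMultiplication-10752` (`…HiddenToeplitzCorners.HiddenCornerLemmaR`),
line `atkinson-lloyd-core-split`, stub `stub_coreClassBound`.  `Z` = lower shift on `ℂ^N`.

`hclR_hconst_rankaware_bound`: if every `T a b − Z (T a b) Zᵀ = (G a b) H₀ᵀ + Γ (C a b) Θᵀ` with ONE
constant right factor `H₀ : N × q` and a CORE with constant outer factors `Γ : N × m₀`, `Θ : N × n₀`
and scalar coefficients `C a b : m₀ × n₀`, the pencil hides a corner `(∑ X a b • T a b) E = F X`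
with `F ≠ 0`, and for every row index `a` and left weight `y : ℂ^{m₀}` the `r × n₀` matrix with rows
`yᵀ (C a b)` has rank `≤ σ` (LEFT SLICE RANK of the core on the row-`a` sub-pencil), then
`r ≤ q + σ`.  `σ = n₀` is always admissible (generator count `r ≤ q + n₀` of `hclR_hconst_bound`),
but e.g. Atkinson's extremal primitive space `S(φ₅)ᵀ` (`5 × 10`, upper rank `4`,
`C(x) = (y ↦ x ∧ y)ᵀ`) has `n₀ = 10` and slice rank `4 = ρ` (`dim {x ∧ y : x} = 4` for `y ≠ 0`).
Proof = the H-constant proof (model `ℂ^N = ℂ[X]/(X^N)`, Stein telescoping,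
`Γ(a) Ψ ≡ φ_a • 1 (mod X^N)`), except that `det (Γ(a) Ψ) = 0` comes from evaluating at every
`z : ℂ`: `Γ(a)(z) = [A | B]`, `B b j = (yᵀ C a b) j` with `y i = ∑_l Γ l i z^l`, so
`rank Γ(a)(z) ≤ q + σ < r`.  Private helpers adapted from `…HiddenCornerLemmaRHConst` (only
`rka_det_mul_eq_zero_of_rank_lt`, `rka_rank_fromCols_le` and the step `heval` are new).

`coreClassBound_p_zero_of_sliceRank_le` (namespace of the line's skeleton): the corresponding
partial discharge of `stub_coreClassBound` (exact binders + `p = 0` + slice rank `≤ 2ρ + q`).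
Open rank-aware pricing question (would settle `p = 0` of the stub once primitivity of the core is
threaded through the split): is the left slice rank of a PRIMITIVE space of upper rank `ρ` ≤ `2ρ`?
-/


set_option linter.dupNamespace false

namespace Summit.MatrixMultiplication.MatrixMultiplication.Theorems

open Polynomial Matrix

/-- Coefficient extraction: the `i`-th coefficient of `∑ C (A l c) X^l` is `A i c`. -/
private theorem rka_coeff_vp {N n : ℕ} (A : Matrix (Fin N) (Fin n) ℂ) (c : Fin n) (i : Fin N) :
    (∑ l : Fin N, C (A l c) * X ^ (l : ℕ)).coeff i = A i c := by
  simp [finsetSum_coeff, Fin.val_inj]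

/-- The coefficients of `∑ C (A l c) X^l` vanish from degree `N` on. -/
private theorem rka_coeff_vp_of_le {N n : ℕ} (A : Matrix (Fin N) (Fin n) ℂ) (c : Fin n)
    {m : ℕ} (hm : N ≤ m) : (∑ l : Fin N, C (A l c) * X ^ (l : ℕ)).coeff m = 0 := by
  simp only [finsetSum_coeff, coeff_C_mul_X_pow]
  refine Finset.sum_eq_zero fun l _ => ?_
  rw [if_neg]
  have := l.is_lt
  omega

/-- Product rule: the column polynomial of `A * S` is a `C`-linear combination of those of `A`. -/
private theorem rka_vp_mul {N n n' : ℕ} (A : Matrix (Fin N) (Fin n) ℂ)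
    (S : Matrix (Fin n) (Fin n') ℂ) (c : Fin n') :
    (∑ l : Fin N, C ((A * S) l c) * X ^ (l : ℕ)) =
      ∑ a : Fin n, (∑ l : Fin N, C (A l a) * X ^ (l : ℕ)) * C (S a c) := by
  simp only [Matrix.mul_apply, map_sum, map_mul, Finset.sum_mul]
  rw [Finset.sum_comm]
  refine Finset.sum_congr rfl fun a _ => Finset.sum_congr rfl fun l _ => ?_
  ring

/-- Entries of `Z * A` for the lower shift `Z`: row `i` of `Z * A` is row `i - 1` of `A`
(and row `0` vanishes). -/
private theorem rka_shift_mul_apply {N n : ℕ} (Z : Matrix (Fin N) (Fin N) ℂ)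
    (hZ : ∀ i j, Z i j = if (i : ℕ) = (j : ℕ) + 1 then 1 else 0)
    (A : Matrix (Fin N) (Fin n) ℂ) (i : Fin N) (c : Fin n) :
    (Z * A) i c = if h : 0 < (i : ℕ) then A ⟨(i : ℕ) - 1, by omega⟩ c else 0 := by
  rw [Matrix.mul_apply]
  split_ifs with h
  · rw [Finset.sum_eq_single ⟨(i : ℕ) - 1, by omega⟩]
    · rw [hZ, if_pos (by simp; omega), one_mul]
    · intro l _ hl
      rw [hZ, if_neg, zero_mul]
      intro h'
      apply hl
      ext
      simp
      omega
    · intro h'; exact absurd (Finset.mem_univ _) h'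
  · refine Finset.sum_eq_zero fun l _ => ?_
    rw [hZ, if_neg (by omega), zero_mul]

/-- Multiplication by the shift is multiplication by `X` modulo `X ^ N`:
`vp (Z * A) ≡ X * vp A (mod X^N)`. -/
private theorem rka_vp_shift_mul {N n : ℕ} (Z : Matrix (Fin N) (Fin N) ℂ)
    (hZ : ∀ i j, Z i j = if (i : ℕ) = (j : ℕ) + 1 then 1 else 0)
    (A : Matrix (Fin N) (Fin n) ℂ) (c : Fin n) :
    (X : ℂ[X]) ^ N ∣ (∑ l : Fin N, C ((Z * A) l c) * X ^ (l : ℕ)) -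
      X * (∑ l : Fin N, C (A l c) * X ^ (l : ℕ)) := by
  rw [X_pow_dvd_iff]
  intro m hm
  rw [coeff_sub, sub_eq_zero]
  have h1 := rka_coeff_vp (Z * A) c ⟨m, hm⟩
  simp only at h1
  rw [h1, rka_shift_mul_apply Z hZ A]
  rcases m with _ | m
  · simp
  · rw [coeff_X_mul, dif_pos (by simp)]
    have h2 := rka_coeff_vp A c ⟨m, by omega⟩
    simp only at h2
    rw [h2]
    rfl

/-- Iterate: `vp (Z ^ k * A) ≡ X ^ k * vp A (mod X^N)`. -/
private theorem rka_vp_shift_pow_mul {N n : ℕ} (Z : Matrix (Fin N) (Fin N) ℂ)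
    (hZ : ∀ i j, Z i j = if (i : ℕ) = (j : ℕ) + 1 then 1 else 0)
    (A : Matrix (Fin N) (Fin n) ℂ) (c : Fin n) (k : ℕ) :
    (X : ℂ[X]) ^ N ∣ (∑ l : Fin N, C ((Z ^ k * A) l c) * X ^ (l : ℕ)) -
      X ^ k * (∑ l : Fin N, C (A l c) * X ^ (l : ℕ)) := by
  induction k with
  | zero => simp
  | succ k ih =>
    have h1 := rka_vp_shift_mul Z hZ (Z ^ k * A) c
    have h2 := (ih.mul_left X).add h1
    rw [pow_succ', Matrix.mul_assoc]
    convert h2 using 1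
    ring

/-- Stein telescoping: if `M - Z M Zᵀ = D` then `M = ∑_{k<n} Z^k D (Zᵀ)^k + Z^n M (Zᵀ)^n`. -/
private theorem rka_stein_telescope {N : ℕ} (Z M D : Matrix (Fin N) (Fin N) ℂ)
    (h : M - Z * M * Zᵀ = D) (n : ℕ) :
    M = (∑ k ∈ Finset.range n, Z ^ k * D * Zᵀ ^ k) + Z ^ n * M * Zᵀ ^ n := by
  induction n with
  | zero => simp
  | succ n ih =>
    have hM : M = D + Z * M * Zᵀ := by rw [← h]; abel
    have step : Z ^ n * M * Zᵀ ^ n =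
        Z ^ n * D * Zᵀ ^ n + Z ^ (n + 1) * M * Zᵀ ^ (n + 1) := by
      conv_lhs => rw [hM]
      rw [pow_succ, pow_succ']
      simp only [Matrix.mul_add, Matrix.add_mul, Matrix.mul_assoc]
    rw [Finset.sum_range_succ, add_assoc, ← step]
    exact ih

/-- Corner per coefficient: testing the corner identity on `X = single a b 1` gives
`T a b * E = F * single a b 1`. -/
private theorem rka_corner_single {r N : ℕ} (T : Fin r → Fin r → Matrix (Fin N) (Fin N) ℂ)
    (E F : Matrix (Fin N) (Fin r) ℂ)
    (hcorner : ∀ X : Matrix (Fin r) (Fin r) ℂ,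
      (∑ a : Fin r, ∑ b : Fin r, X a b • T a b) * E = F * X)
    (a b : Fin r) :
    T a b * E = F * Matrix.single a b (1 : ℂ) := by
  have h := hcorner (Matrix.single a b 1)
  have hs : (∑ a' : Fin r, ∑ b' : Fin r, Matrix.single a b (1 : ℂ) a' b' • T a' b') = T a b := by
    simp [Matrix.single_apply, ite_and, ite_smul, Finset.sum_ite_eq]
  rw [hs] at h
  exact h

/-- Over `ℂ[X]`, a product `Γ * Ψ` (`r × d` by `d × r`) has zero determinant as soon as every
EVALUATION of `Γ` has rank `< r` (evaluate at every point of the infinite field `ℂ`).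
-- adapted from `hconst_det_mul_eq_zero_of_lt` (width bound replaced by a pointwise rank bound) -/
private theorem rka_det_mul_eq_zero_of_rank_lt {r d : ℕ}
    (Γ : Matrix (Fin r) (Fin d) ℂ[X]) (Ψ : Matrix (Fin d) (Fin r) ℂ[X])
    (hΓ : ∀ z : ℂ, (Γ.map (evalRingHom z)).rank < r) : (Γ * Ψ).det = 0 := by
  refine Polynomial.funext fun z => ?_
  rw [eval_zero, ← coe_evalRingHom, RingHom.map_det, RingHom.mapMatrix_apply, Matrix.map_mul]
  by_contra hne
  have hU : IsUnit (Γ.map (evalRingHom z) * Ψ.map (evalRingHom z)) :=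
    (Matrix.isUnit_iff_isUnit_det _).mpr (isUnit_iff_ne_zero.mpr hne)
  have h1 := Matrix.rank_of_isUnit _ hU
  have h2 := Matrix.rank_mul_le_left (Γ.map (evalRingHom z)) (Ψ.map (evalRingHom z))
  have h3 := hΓ z
  rw [Fintype.card_fin] at h1
  omega

/-- Sub-additivity of matrix rank over `ℂ` (folklore). -/
private theorem rka_rank_add_le {m n : Type*} [Fintype m] [Fintype n] [DecidableEq n]
    (A B : Matrix m n ℂ) : (A + B).rank ≤ A.rank + B.rank := by
  unfold Matrix.rank
  rw [Matrix.mulVecLin_add]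
  exact (Submodule.finrank_mono (LinearMap.range_add_le _ _)).trans
    (Submodule.finrank_add_le_finrank_add_finrank _ _)

/-- `rank [A | B] ≤ rank A + rank B`. -/
private theorem rka_rank_fromCols_le {m q n : ℕ} (A : Matrix (Fin m) (Fin q) ℂ)
    (B : Matrix (Fin m) (Fin n) ℂ) : (Matrix.fromCols A B).rank ≤ A.rank + B.rank := by
  have hsplit : Matrix.fromCols A B =
      A * Matrix.fromCols (1 : Matrix (Fin q) (Fin q) ℂ) (0 : Matrix (Fin q) (Fin n) ℂ) +
      B * Matrix.fromCols (0 : Matrix (Fin n) (Fin q) ℂ) (1 : Matrix (Fin n) (Fin n) ℂ) := by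
    rw [Matrix.mul_fromCols, Matrix.mul_fromCols]
    ext i j
    rcases j with j | j <;> simp
  rw [hsplit]
  exact (rka_rank_add_le _ _).trans
    (Nat.add_le_add (Matrix.rank_mul_le_left _ _) (Matrix.rank_mul_le_left _ _))

/-- Key congruence.  For fixed `a b c`, modulo `X ^ N`,
`∑ j vp(col j of G a b) * Ψ j c ≡ [b = c] · vp(col a of F)`, where
`Ψ j c = ∑_{k<N} X^k C ((H₀ᵀ (Zᵀ)^k E) j c)`. -/
private theorem rka_key_congr {r N d : ℕ} (Z : Matrix (Fin N) (Fin N) ℂ)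
    (hZ : ∀ i j, Z i j = if (i : ℕ) = (j : ℕ) + 1 then 1 else 0)
    (T : Fin r → Fin r → Matrix (Fin N) (Fin N) ℂ) (E F : Matrix (Fin N) (Fin r) ℂ)
    (H₀ : Matrix (Fin N) (Fin d) ℂ) (G : Fin r → Fin r → Matrix (Fin N) (Fin d) ℂ)
    (hcorner : ∀ X : Matrix (Fin r) (Fin r) ℂ,
      (∑ a : Fin r, ∑ b : Fin r, X a b • T a b) * E = F * X)
    (hdisp : ∀ a b, T a b - Z * T a b * Zᵀ = G a b * H₀ᵀ) (a b c : Fin r) :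
    (X : ℂ[X]) ^ N ∣ (∑ j : Fin d, (∑ l : Fin N, C (G a b l j) * X ^ (l : ℕ)) *
        (∑ k ∈ Finset.range N, X ^ k * C ((H₀ᵀ * Zᵀ ^ k * E) j c))) -
      (if b = c then ∑ l : Fin N, C (F l a) * X ^ (l : ℕ) else 0) := by
  rw [← Ideal.mem_span_singleton, ← Ideal.Quotient.eq]
  set π := Ideal.Quotient.mk (Ideal.span {(X : ℂ[X]) ^ N}) with hπdef
  have hπk : ∀ {n : ℕ} (A : Matrix (Fin N) (Fin n) ℂ) (c : Fin n) (k : ℕ),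
      π (∑ l : Fin N, C ((Z ^ k * A) l c) * X ^ (l : ℕ)) =
        π (X ^ k * ∑ l : Fin N, C (A l c) * X ^ (l : ℕ)) := by
    intro n A c k
    rw [Ideal.Quotient.eq, Ideal.mem_span_singleton]
    exact rka_vp_shift_pow_mul Z hZ A c k
  have hπN : π (X ^ N) = 0 :=
    Ideal.Quotient.eq_zero_iff_mem.mpr (Ideal.mem_span_singleton_self _)
  have hTE : T a b * E = (∑ k ∈ Finset.range N, Z ^ k * (G a b * (H₀ᵀ * Zᵀ ^ k * E))) +
      Z ^ N * (T a b * Zᵀ ^ N * E) := by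
    conv_lhs => rw [rka_stein_telescope Z (T a b) (G a b * H₀ᵀ) (hdisp a b) N]
    simp only [Matrix.add_mul, Matrix.sum_mul, Matrix.mul_assoc]
  have h1 : (∑ l : Fin N, C ((T a b * E) l c) * X ^ (l : ℕ)) =
      if b = c then ∑ l : Fin N, C (F l a) * X ^ (l : ℕ) else 0 := by
    rw [rka_corner_single T E F hcorner a b, rka_vp_mul]
    simp only [Matrix.single_apply]
    rw [Finset.sum_eq_single a]
    · by_cases hbc : b = c <;> simp [hbc]
    · intro a' _ ha'
      simp [Ne.symm ha']
    · intro h; exact absurd (Finset.mem_univ a) h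
  have h2 : (∑ l : Fin N, C ((T a b * E) l c) * X ^ (l : ℕ)) =
      (∑ k ∈ Finset.range N, ∑ l : Fin N,
        C ((Z ^ k * (G a b * (H₀ᵀ * Zᵀ ^ k * E))) l c) * X ^ (l : ℕ)) +
      ∑ l : Fin N, C ((Z ^ N * (T a b * Zᵀ ^ N * E)) l c) * X ^ (l : ℕ) := by
    rw [hTE]
    simp only [Matrix.add_apply, Matrix.sum_apply, map_add, map_sum, add_mul, Finset.sum_mul,
      Finset.sum_add_distrib]
    congr 1
    exact Finset.sum_comm
  have h3 : (∑ j : Fin d, (∑ l : Fin N, C (G a b l j) * X ^ (l : ℕ)) *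
        (∑ k ∈ Finset.range N, X ^ k * C ((H₀ᵀ * Zᵀ ^ k * E) j c))) =
      ∑ k ∈ Finset.range N, X ^ k *
        ∑ l : Fin N, C ((G a b * (H₀ᵀ * Zᵀ ^ k * E)) l c) * X ^ (l : ℕ) := by
    simp_rw [rka_vp_mul]
    simp only [Finset.mul_sum]
    rw [Finset.sum_comm]
    refine Finset.sum_congr rfl fun k _ => Finset.sum_congr rfl fun j _ => ?_
    ring
  rw [← h1, h2, h3, map_add, map_sum, map_sum, hπk _ _ N, map_mul, hπN, zero_mul, add_zero]
  exact Finset.sum_congr rfl fun k _ => (hπk _ _ k).symm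

/-- **Rank-aware H-constant lemma.** If every `T a b − Z (T a b) Zᵀ = (G a b) H₀ᵀ + Γ (C a b) Θᵀ`
(ONE constant right factor `H₀ : N × q`, a core with constant outer factors `Γ : N × m₀`,
`Θ : N × n₀`), the pencil hides a corner `(Σ X a b • T a b) E = F X` with `F ≠ 0`, and every left
slice `b ↦ yᵀ (C a b)` of the core (`a` fixed, `y : ℂ^{m₀}`) has rank `≤ σ`, then `r ≤ q + σ`
(no rank hypothesis on `E`, `F`, `Γ`, `Θ`, no nonsingularity). -/
theorem hclR_hconst_rankaware_bound (r N q m₀ n₀ σ : ℕ) (T : Fin r → Fin r → Matrix (Fin N) (Fin N) ℂ)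
    (E F : Matrix (Fin N) (Fin r) ℂ) (H₀ : Matrix (Fin N) (Fin q) ℂ) (G : Fin r → Fin r → Matrix (Fin N) (Fin q) ℂ)
    (Γ : Matrix (Fin N) (Fin m₀) ℂ) (Θ : Matrix (Fin N) (Fin n₀) ℂ) (C : Fin r → Fin r → Matrix (Fin m₀) (Fin n₀) ℂ)
    (hF : F ≠ 0)
    (hcorner : ∀ X : Matrix (Fin r) (Fin r) ℂ, (∑ a : Fin r, ∑ b : Fin r, X a b • T a b) * E = F * X)
    (hdisp : ∀ a b, T a b - (Matrix.of fun i j : Fin N => if (i : ℕ) = (j : ℕ) + 1 then (1 : ℂ) else 0) * T a b * (Matrix.of fun i j : Fin N => if (i : ℕ) = (j : ℕ) + 1 then (1 : ℂ) else 0)ᵀ = G a b * H₀ᵀ + Γ * C a b * Θᵀ)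
    (hσ : ∀ (a : Fin r) (y : Fin m₀ → ℂ), (Matrix.of fun (b : Fin r) (j : Fin n₀) => (y ᵥ* C a b) j).rank ≤ σ) :
    r ≤ q + σ := by
  set Z : Matrix (Fin N) (Fin N) ℂ :=
    Matrix.of fun i j : Fin N => if (i : ℕ) = (j : ℕ) + 1 then (1 : ℂ) else 0 with hZdef
  have hZ : ∀ i j, Z i j = if (i : ℕ) = (j : ℕ) + 1 then (1 : ℂ) else 0 := fun i j => rfl
  by_contra hlt
  push Not at hlt
  -- combined right factor `[H₀ | Θ]` and varying left factor `[G a b | Γ C a b]`, on `Fin (q + n₀)`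
  set H₀' : Matrix (Fin N) (Fin (q + n₀)) ℂ := (Matrix.fromCols H₀ Θ).submatrix id finSumFinEquiv.symm with hH₀'
  set G' : Fin r → Fin r → Matrix (Fin N) (Fin (q + n₀)) ℂ := fun a b =>
    (Matrix.fromCols (G a b) (Γ * C a b)).submatrix id finSumFinEquiv.symm with hG'
  have hdisp' : ∀ a b, T a b - Z * T a b * Zᵀ = G' a b * H₀'ᵀ := by
    intro a b
    rw [hdisp a b, hG', hH₀', Matrix.transpose_submatrix, Matrix.submatrix_mul_equiv,
      Matrix.transpose_fromCols, Matrix.fromCols_mul_fromRows, Matrix.submatrix_id_id, Matrix.mul_assoc]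
  -- a nonzero entry of `F`
  obtain ⟨i₀, a, ha⟩ : ∃ i a, F i a ≠ 0 := by
    by_contra h; push Not at h; exact hF (Matrix.ext fun i j => by simpa using h i j)
  -- polynomial data attached to the row index `a`
  set φ : ℂ[X] := ∑ l : Fin N, Polynomial.C (F l a) * X ^ (l : ℕ) with hφdef
  set Γp : Matrix (Fin r) (Fin (q + n₀)) ℂ[X] := Matrix.of fun b j => ∑ l : Fin N, Polynomial.C (G' a b l j) * X ^ (l : ℕ) with hΓdef
  set Ψ : Matrix (Fin (q + n₀)) (Fin r) ℂ[X] := Matrix.of fun j c => ∑ k ∈ Finset.range N, X ^ k * Polynomial.C ((H₀'ᵀ * Zᵀ ^ k * E) j c) with hΨdef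
  have hkey : ∀ b c, ∃ y : ℂ[X], (Γp * Ψ) b c - (if b = c then φ else 0) = X ^ N * y := by
    intro b c
    obtain ⟨y, hy⟩ := rka_key_congr Z hZ T E F H₀' G' hcorner hdisp' a b c
    exact ⟨y, by rw [← hy, Matrix.mul_apply]; rfl⟩
  choose Y hY using hkey
  -- pointwise rank bound for the evaluations of `Γp`
  have hrank : ∀ z : ℂ, (Γp.map (evalRingHom z)).rank < r := by
    intro z
    set y : Fin m₀ → ℂ := fun i => ∑ l : Fin N, Γ l i * z ^ (l : ℕ) with hy
    set A : Matrix (Fin r) (Fin q) ℂ := Matrix.of fun b k => ∑ l : Fin N, G a b l k * z ^ (l : ℕ) with hA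
    set B : Matrix (Fin r) (Fin n₀) ℂ := Matrix.of fun (b : Fin r) (j : Fin n₀) => (y ᵥ* C a b) j with hB
    have heval : Γp.map (evalRingHom z) = (Matrix.fromCols A B).submatrix id finSumFinEquiv.symm := by
      ext b j
      simp only [hΓdef, hG', Matrix.map_apply, Matrix.of_apply, coe_evalRingHom, eval_finsetSum,
        eval_mul, eval_C, eval_pow, eval_X, Matrix.submatrix_apply, id_eq]
      rcases finSumFinEquiv.symm j with k | j'
      · simp only [Matrix.fromCols_apply_inl, hA, Matrix.of_apply]
      · simp only [Matrix.fromCols_apply_inr, hB, Matrix.of_apply, Matrix.vecMul, dotProduct, hy,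
          Matrix.mul_apply, Finset.sum_mul]
        rw [Finset.sum_comm]
        refine Finset.sum_congr rfl fun i _ => Finset.sum_congr rfl fun l _ => ?_
        ring
    rw [heval]
    calc ((Matrix.fromCols A B).submatrix id finSumFinEquiv.symm).rank
        ≤ (Matrix.fromCols A B).rank := Matrix.rank_submatrix_le _ _ _
      _ ≤ A.rank + B.rank := rka_rank_fromCols_le A B
      _ ≤ q + σ := Nat.add_le_add (Matrix.rank_le_width A) (hσ a y)
      _ < r := hlt
  -- `φ ≠ 0` and its factorisation `φ = X ^ m * u` with `u.coeff 0 ≠ 0` and `m < N`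
  have hφ0 : φ ≠ 0 := by
    intro h
    apply ha
    have := rka_coeff_vp F a i₀
    rw [← hφdef, h, coeff_zero] at this
    exact this.symm
  obtain ⟨u, hu, hXu⟩ := exists_eq_pow_rootMultiplicity_mul_and_not_dvd φ hφ0 0
  rw [map_zero, sub_zero] at hu hXu
  rw [X_dvd_iff] at hXu
  set m := rootMultiplicity 0 φ with hmdef
  have hmN : m < N := by
    by_contra hle
    push Not at hle
    apply hφ0
    ext n
    rw [coeff_zero]
    rcases lt_or_ge n N with hn | hn
    · have hdvd : (X : ℂ[X]) ^ N ∣ φ := (pow_dvd_pow X hle).trans ⟨u, hu⟩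
      exact (X_pow_dvd_iff.mp hdvd) n hn
    · exact rka_coeff_vp_of_le F a hn
  have hXN : (X : ℂ[X]) ^ N = X ^ m * X ^ (N - m) := by
    rw [← pow_add, Nat.add_sub_cancel' hmN.le]
  -- factor the product matrix: `Γp * Ψ = X ^ m • (u • 1 + X ^ (N - m) • Y)`
  have hprod : Γp * Ψ = (X : ℂ[X]) ^ m •
      Matrix.of (fun b c => (if b = c then u else 0) + X ^ (N - m) * Y b c) := by
    ext b c
    have e := hY b c
    rw [sub_eq_iff_eq_add] at e
    rw [e, Matrix.smul_apply, Matrix.of_apply, smul_eq_mul, hXN]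
    split_ifs with hbc
    · rw [hu]; ring_nf
    · ring_nf
  -- determinants: `det (Γp * Ψ) = 0`, but the right-hand side has nonzero determinant
  have hdet := rka_det_mul_eq_zero_of_rank_lt Γp Ψ hrank
  rw [hprod, Matrix.det_smul, Fintype.card_fin, mul_eq_zero] at hdet
  rcases hdet with h | h
  · exact (pow_ne_zero _ (pow_ne_zero _ X_ne_zero)) h
  · have h' := congrArg (eval 0) h
    rw [eval_zero, ← coe_evalRingHom, RingHom.map_det, RingHom.mapMatrix_apply] at h'
    have hmap : (Matrix.of fun b c => (if b = c then u else 0) + X ^ (N - m) * Y b c).map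
        (evalRingHom 0) = Matrix.diagonal fun _ => eval 0 u := by
      ext b c
      simp only [Matrix.map_apply, Matrix.of_apply, coe_evalRingHom, eval_add, eval_mul, eval_pow,
        eval_X, Matrix.diagonal_apply]
      rw [zero_pow (Nat.sub_ne_zero_of_lt hmN), zero_mul, add_zero]
      split_ifs <;> simp
    rw [hmap, Matrix.det_diagonal, Finset.prod_const, Finset.card_univ, Fintype.card_fin] at h'
    apply hXu
    rw [coeff_zero_eq_eval_zero]
    exact (pow_eq_zero_iff (by omega)).mp h'

end Summit.MatrixMultiplication.MatrixMultiplication.Theorems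

namespace Summit.MatrixMultiplication.MatrixMultiplication.Cruxes.HiddenCornerLemmaR.AtkinsonLloydCoreSplit

open Matrix
open Summit.MatrixMultiplication.MatrixMultiplication.Theorems (hclR_hconst_rankaware_bound)

/-- **Case `p = 0`, left slice rank `≤ 2ρ + q`** of the registered stub `stub_coreClassBound` (line
`atkinson-lloyd-core-split`; the stub's exact binders, two extra hypotheses in front): with no left
border rows the displacement is `(G₁ a b) H₀ᵀ + Γ (C a b) Θᵀ` and `hclR_hconst_rankaware_bound` prices
the core by its left slice rank instead of its number `n₀` of right generators (slice rank `n₀` is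
always admissible and gives back `r ≤ q + n₀`; primitive cores such as `S(φ₅)ᵀ` have slice rank
`ρ < n₀`; for the exterior families `x ↦ x ∧ ·` it is `≤ ρ + 1`). -/
theorem coreClassBound_p_zero_of_sliceRank_le :
    ∀ (r N p q ρ m₀ n₀ : ℕ) (T : Fin r → Fin r → Matrix (Fin N) (Fin N) ℂ) (E F : Matrix (Fin N) (Fin r) ℂ)
    (G₀ : Matrix (Fin N) (Fin p) ℂ) (H₀ : Matrix (Fin N) (Fin q) ℂ) (Γ : Matrix (Fin N) (Fin m₀) ℂ) (Θ : Matrix (Fin N) (Fin n₀) ℂ)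
    (H₁ : Fin r → Fin r → Matrix (Fin N) (Fin p) ℂ) (G₁ : Fin r → Fin r → Matrix (Fin N) (Fin q) ℂ) (C : Fin r → Fin r → Matrix (Fin m₀) (Fin n₀) ℂ),
    p = 0 → (∀ (a : Fin r) (y : Fin m₀ → ℂ), (Matrix.of fun (b : Fin r) (j : Fin n₀) => (y ᵥ* C a b) j).rank ≤ 2 * ρ + q) →
    0 < m₀ → 0 < n₀ → 2 * m₀ ≤ ρ * (ρ + 1) → 2 * n₀ ≤ ρ * (ρ + 1) →
    E.rank = r → F.rank = r →
    (Matrix.fromCols G₀ Γ).rank = p + m₀ → (Matrix.fromCols H₀ Θ).rank = q + n₀ →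
    (∀ X : Matrix (Fin r) (Fin r) ℂ, (∑ a : Fin r, ∑ b : Fin r, X a b • C a b).rank ≤ ρ) →
    (∀ X : Matrix (Fin r) (Fin r) ℂ, (∑ a : Fin r, ∑ b : Fin r, X a b • T a b) * E = F * X) →
    (∀ a b, T a b - (Matrix.of fun i j : Fin N => if (i : ℕ) = (j : ℕ) + 1 then (1 : ℂ) else 0) * T a b * (Matrix.of fun i j : Fin N => if (i : ℕ) = (j : ℕ) + 1 then (1 : ℂ) else 0)ᵀ = G₀ * (H₁ a b)ᵀ + G₁ a b * H₀ᵀ + Γ * C a b * Θᵀ) →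
    (∃ X₀ : Matrix (Fin r) (Fin r) ℂ, (∑ a : Fin r, ∑ b : Fin r, X₀ a b • T a b).det ≠ 0) →
    (∀ c : ℕ, (∀ i : Fin N, (i : ℕ) < c → (∀ k : Fin p, G₀ i k = 0) ∧ (∀ k : Fin m₀, Γ i k = 0)) →
      ∀ (a : Fin r) (i : Fin N), (i : ℕ) < c → F i a = 0) →
    r ≤ 2 * (p + q + ρ) := by
  intro r N p q ρ m₀ n₀ T E F G₀ H₀ Γ Θ H₁ G₁ C hp hσ _ _ _ _ _ hF _ _ _ hcorner hdsp _ _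
  subst hp
  rcases Nat.eq_zero_or_pos r with hr | hr
  · omega
  have hFne : F ≠ 0 := by rintro rfl; rw [Matrix.rank_zero] at hF; omega
  have hdsp' : ∀ a b, T a b - (Matrix.of fun i j : Fin N => if (i : ℕ) = (j : ℕ) + 1 then (1 : ℂ) else 0) * T a b * (Matrix.of fun i j : Fin N => if (i : ℕ) = (j : ℕ) + 1 then (1 : ℂ) else 0)ᵀ = G₁ a b * H₀ᵀ + Γ * C a b * Θᵀ := by
    intro a b
    have h0 : G₀ * (H₁ a b)ᵀ = 0 := by ext i j; simp [Matrix.mul_apply]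
    rw [hdsp a b, h0, zero_add]
  have h := hclR_hconst_rankaware_bound r N q m₀ n₀ (2 * ρ + q) T E F H₀ G₁ Γ Θ C hFne hcorner hdsp' hσ
  omega

end Summit.MatrixMultiplication.MatrixMultiplication.Cruxes.HiddenCornerLemmaR.AtkinsonLloydCoreSplit
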